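import Summits.QuantumAdvantage.QuantumAdvantage.Theorems.CubicForrelationNearExactIsExactCubicFormR4Cells
import Summits.QuantumAdvantage.QuantumAdvantage.Theorems.CubicForrelationNearExactIsExactCubicFormUnitTable

/-!
# Crux `CubicForrelation.NearExactIsExact` (stmt-QuantumAdvantage-14043) — E1280-even, R4 branch, levels `HL h`: INDEX TABLES and the
  SHARING of the normal form by all cells

Certificate seat `b2b-cforr-cert` (gen 42).  HONEST FRAMING: kernel-checked bookkeeping (standard axioms), the R4 analogue of
…CubicFormR2PartnerLevelTables: inside `HL h` of …CubicFormR4PartnerDispatch the light cell's third differences come in the `Fin.castLE hk`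
coordinates of `Fin 7`; the cell lemmas (`tl2_cell_halves`, `tlu_unit_table`, …) want the `Fin (1 + 6)` format with index maps
`lo, hi : Fin h → Fin 6` (`lo a = a`, `hi a = h + a`).  `tpw_R4_level_tables` does the conversion for ANY cell prefix `p ∈ 𝔽₂⁵` and tabulates
the cubic form on the `z`-block: `d(z₀, ·, ·) = Σ_q [{·,·} = {z_{1+lo q}, z_{1+hi q}}]`, `d(z_{1+lo q}, ·, ·) = [{·,·} = {z₀, z_{1+hi q}}]`,
`d(z_{1+hi q}, ·, ·) = [{·,·} = {z₀, z_{1+lo q}}]` (`tlu_unit_table` + `tc5_third_rho_unit`).  `tc5_third_rho` / `tpw_R4_cells_share` move the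
normal form from one cell to every cell (third differences of a cubic are base-point free).  Nothing about `θ₁₂`; NOT summit progress.

References: this seat lineage (g37 R4-PARTNER §1, g41 `tlu_unit_table`).  Axioms: the standard three.
-/

set_option linter.dupNamespace false -- D-0017: single-problem summit ⇒ `QuantumAdvantage.QuantumAdvantage` by design

namespace Summit.QuantumAdvantage.QuantumAdvantage.Theorems.CubicForrelation.NearExactIsExact

open Finset
open Literature.Computability.QuantumComplexity
open Literature.Computability.QuantumComplexity.BuzetChailloux (bxor zeroVec bxor_comm bxor_self bxor_zeroVec zeroVec_bxor
  bxor_bxor_cancel_left)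

variable {k m : ℕ}

/-- **Third differences of a cell are third differences of `κ`** (any `κ`, any prefix, any vectors). [folklore] -/
theorem tc5_third_rho (κ : (Fin (k + m) → Bool) → Bool) (p : Fin k → Bool) (u v w x : Fin m → Bool) :
    (((κ (Fin.append p x) ^^ κ (Fin.append p (bxor x w))) ^^ (κ (Fin.append p (bxor x v)) ^^ κ (Fin.append p (bxor (bxor x v) w)))) ^^
        ((κ (Fin.append p (bxor x u)) ^^ κ (Fin.append p (bxor (bxor x u) w))) ^^
          (κ (Fin.append p (bxor (bxor x u) v)) ^^ κ (Fin.append p (bxor (bxor (bxor x u) v) w))))) =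
      (((κ (Fin.append p x) ^^ κ (bxor (Fin.append p x) (Fin.append zeroVec w))) ^^
          (κ (bxor (Fin.append p x) (Fin.append zeroVec v)) ^^ κ (bxor (bxor (Fin.append p x) (Fin.append zeroVec v)) (Fin.append zeroVec w)))) ^^
        ((κ (bxor (Fin.append p x) (Fin.append zeroVec u)) ^^ κ (bxor (bxor (Fin.append p x) (Fin.append zeroVec u)) (Fin.append zeroVec w))) ^^
          (κ (bxor (bxor (Fin.append p x) (Fin.append zeroVec u)) (Fin.append zeroVec v)) ^^
            κ (bxor (bxor (bxor (Fin.append p x) (Fin.append zeroVec u)) (Fin.append zeroVec v)) (Fin.append zeroVec w))))) := by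
  simp only [tc5_append_bxor, bxor_zeroVec]

/-- **All cells share their third differences.**  For `deg κ ≤ 3`, if the third differences of the cell `ρ_p` are given by a base-point
free table `R`, then so are those of every other cell `ρ_{p'}`. [this work] -/
theorem tpw_R4_cells_share (κ : (Fin (k + m) → Bool) → Bool) (hκ : IsDegLeFun 3 κ) (p p' : Fin k → Bool)
    (R : (Fin m → Bool) → (Fin m → Bool) → (Fin m → Bool) → Bool)
    (hT : ∀ u v w x : Fin m → Bool,
      (((κ (Fin.append p x) ^^ κ (Fin.append p (bxor x w))) ^^ (κ (Fin.append p (bxor x v)) ^^ κ (Fin.append p (bxor (bxor x v) w)))) ^^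
          ((κ (Fin.append p (bxor x u)) ^^ κ (Fin.append p (bxor (bxor x u) w))) ^^
            (κ (Fin.append p (bxor (bxor x u) v)) ^^ κ (Fin.append p (bxor (bxor (bxor x u) v) w))))) = R u v w) :
    ∀ u v w x : Fin m → Bool,
      (((κ (Fin.append p' x) ^^ κ (Fin.append p' (bxor x w))) ^^ (κ (Fin.append p' (bxor x v)) ^^ κ (Fin.append p' (bxor (bxor x v) w)))) ^^
          ((κ (Fin.append p' (bxor x u)) ^^ κ (Fin.append p' (bxor (bxor x u) w))) ^^
            (κ (Fin.append p' (bxor (bxor x u) v)) ^^ κ (Fin.append p' (bxor (bxor (bxor x u) v) w))))) = R u v w := by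
  intro u v w x
  rw [tc5_third_rho, tcf_third_const κ hκ (Fin.append zeroVec u) (Fin.append zeroVec v) (Fin.append zeroVec w) (Fin.append p' x)
    (Fin.append p x), ← tc5_third_rho]
  exact hT u v w x

/-- **Index tables for level `h` (R4).**  For a cubic `κ` on `5 + 7` bits with cubic form `d` (3-form law) and a cell prefix `p` whose
third differences have the normal form `u₀·ω(v,w) ⊕ v₀·ω(u,w) ⊕ w₀·ω(u,v)`, `ω = Σ_{i<h} s_{1+i} ∧ s_{1+h+i}` in the `Fin.castLE hk`
coordinates: the index maps `lo a = a`, `hi a = h + a` (`Fin h → Fin 6`) are injective with disjoint images, the same normal form holds in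
the `Fin (1 + 6)` format, and `d` on the `z`-block is tabulated: `d(z₀,·,·) = Σ_q [{·,·} = {z_{1+lo q}, z_{1+hi q}}]`,
`d(z_{1+lo q},·,·) = [{·,·} = {z₀, z_{1+hi q}}]`, `d(z_{1+hi q},·,·) = [{·,·} = {z₀, z_{1+lo q}}]`. [this work] -/
theorem tpw_R4_level_tables (κ : (Fin (5 + 7) → Bool) → Bool) (hκ : IsDegLeFun 3 κ)
    (d : Fin (5 + 7) → Fin (5 + 7) → Fin (5 + 7) → ZMod 2)
    (hd : ∀ φ j k, d φ j k =
      if ((((κ zeroVec ^^ κ (bxor zeroVec (fun l => decide (l = k)))) ^^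
            (κ (bxor zeroVec (fun l => decide (l = j))) ^^ κ (bxor (bxor zeroVec (fun l => decide (l = j))) (fun l => decide (l = k))))) ^^
          ((κ (bxor zeroVec (fun l => decide (l = φ))) ^^ κ (bxor (bxor zeroVec (fun l => decide (l = φ))) (fun l => decide (l = k)))) ^^
            (κ (bxor (bxor zeroVec (fun l => decide (l = φ))) (fun l => decide (l = j))) ^^
              κ (bxor (bxor (bxor zeroVec (fun l => decide (l = φ))) (fun l => decide (l = j))) (fun l => decide (l = k))))))) = true
      then 1 else 0)
    (p : Fin 5 → Bool) (h : ℕ) (hk : 1 + h + h ≤ 7)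
    (hT : ∀ u v w x : Fin 7 → Bool,
      ((((κ (Fin.append p x) ^^ κ (Fin.append p (bxor x w))) ^^
              (κ (Fin.append p (bxor x v)) ^^ κ (Fin.append p (bxor (bxor x v) w)))) ^^
            ((κ (Fin.append p (bxor x u)) ^^ κ (Fin.append p (bxor (bxor x u) w))) ^^
              (κ (Fin.append p (bxor (bxor x u) v)) ^^
                κ (Fin.append p (bxor (bxor (bxor x u) v) w)))))) =
      ((((u (Fin.castLE hk (Fin.castAdd h (Fin.castAdd h (0 : Fin 1)))) &&
            decide ((∑ ii : Fin h, ((if v (Fin.castLE hk (Fin.castAdd h (Fin.natAdd 1 ii))) = true then (1 : ZMod 2) else 0) * (if w (Fin.castLE hk (Fin.natAdd (1 + h) ii)) = true then (1 : ZMod 2) else 0) +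
              (if v (Fin.castLE hk (Fin.natAdd (1 + h) ii)) = true then (1 : ZMod 2) else 0) * (if w (Fin.castLE hk (Fin.castAdd h (Fin.natAdd 1 ii))) = true then (1 : ZMod 2) else 0))) = 1)) ^^
          (v (Fin.castLE hk (Fin.castAdd h (Fin.castAdd h (0 : Fin 1)))) &&
            decide ((∑ ii : Fin h, ((if u (Fin.castLE hk (Fin.castAdd h (Fin.natAdd 1 ii))) = true then (1 : ZMod 2) else 0) * (if w (Fin.castLE hk (Fin.natAdd (1 + h) ii)) = true then (1 : ZMod 2) else 0) +
              (if u (Fin.castLE hk (Fin.natAdd (1 + h) ii)) = true then (1 : ZMod 2) else 0) * (if w (Fin.castLE hk (Fin.castAdd h (Fin.natAdd 1 ii))) = true then (1 : ZMod 2) else 0))) = 1))) ^^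
          (w (Fin.castLE hk (Fin.castAdd h (Fin.castAdd h (0 : Fin 1)))) &&
            decide ((∑ ii : Fin h, ((if u (Fin.castLE hk (Fin.castAdd h (Fin.natAdd 1 ii))) = true then (1 : ZMod 2) else 0) * (if v (Fin.castLE hk (Fin.natAdd (1 + h) ii)) = true then (1 : ZMod 2) else 0) +
              (if u (Fin.castLE hk (Fin.natAdd (1 + h) ii)) = true then (1 : ZMod 2) else 0) * (if v (Fin.castLE hk (Fin.castAdd h (Fin.natAdd 1 ii))) = true then (1 : ZMod 2) else 0))) = 1))))) :
    ∃ (lo hi : Fin h → Fin 6),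
      Function.Injective lo ∧ Function.Injective hi ∧ (∀ a b, lo a ≠ hi b) ∧
      (∀ a, (lo a).val = a.val) ∧ (∀ a, (hi a).val = h + a.val) ∧
      (∀ u v w x : Fin (1 + 6) → Bool,
        ((((κ (Fin.append p x) ^^ κ (Fin.append p (bxor x w))) ^^
              (κ (Fin.append p (bxor x v)) ^^ κ (Fin.append p (bxor (bxor x v) w)))) ^^
            ((κ (Fin.append p (bxor x u)) ^^ κ (Fin.append p (bxor (bxor x u) w))) ^^
              (κ (Fin.append p (bxor (bxor x u) v)) ^^
                κ (Fin.append p (bxor (bxor (bxor x u) v) w)))))) =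
        ((((u (Fin.castAdd 6 (0 : Fin 1)) &&
            decide ((∑ ii : Fin h, ((if (fun jj => v (Fin.natAdd 1 jj)) (lo ii) = true then (1 : ZMod 2) else 0) * (if (fun jj => w (Fin.natAdd 1 jj)) (hi ii) = true then (1 : ZMod 2) else 0) +
              (if (fun jj => v (Fin.natAdd 1 jj)) (hi ii) = true then (1 : ZMod 2) else 0) * (if (fun jj => w (Fin.natAdd 1 jj)) (lo ii) = true then (1 : ZMod 2) else 0))) = 1)) ^^
          (v (Fin.castAdd 6 (0 : Fin 1)) &&
            decide ((∑ ii : Fin h, ((if (fun jj => u (Fin.natAdd 1 jj)) (lo ii) = true then (1 : ZMod 2) else 0) * (if (fun jj => w (Fin.natAdd 1 jj)) (hi ii) = true then (1 : ZMod 2) else 0) +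
              (if (fun jj => u (Fin.natAdd 1 jj)) (hi ii) = true then (1 : ZMod 2) else 0) * (if (fun jj => w (Fin.natAdd 1 jj)) (lo ii) = true then (1 : ZMod 2) else 0))) = 1))) ^^
          (w (Fin.castAdd 6 (0 : Fin 1)) &&
            decide ((∑ ii : Fin h, ((if (fun jj => u (Fin.natAdd 1 jj)) (lo ii) = true then (1 : ZMod 2) else 0) * (if (fun jj => v (Fin.natAdd 1 jj)) (hi ii) = true then (1 : ZMod 2) else 0) +
              (if (fun jj => u (Fin.natAdd 1 jj)) (hi ii) = true then (1 : ZMod 2) else 0) * (if (fun jj => v (Fin.natAdd 1 jj)) (lo ii) = true then (1 : ZMod 2) else 0))) = 1))))) ∧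
      (∀ s u : Fin (1 + 6), d (Fin.natAdd 5 (Fin.castAdd 6 (0 : Fin 1))) (Fin.natAdd 5 s) (Fin.natAdd 5 u) =
        ∑ q, (if (s = Fin.natAdd 1 (lo q) ∧ u = Fin.natAdd 1 (hi q)) ∨ (s = Fin.natAdd 1 (hi q) ∧ u = Fin.natAdd 1 (lo q))
          then (1 : ZMod 2) else 0)) ∧
      (∀ q (s u : Fin (1 + 6)), d (Fin.natAdd 5 (Fin.natAdd 1 (lo q))) (Fin.natAdd 5 s) (Fin.natAdd 5 u) =
        if (s = Fin.castAdd 6 (0 : Fin 1) ∧ u = Fin.natAdd 1 (hi q)) ∨ (s = Fin.natAdd 1 (hi q) ∧ u = Fin.castAdd 6 (0 : Fin 1)) then 1 else 0) ∧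
      (∀ q (s u : Fin (1 + 6)), d (Fin.natAdd 5 (Fin.natAdd 1 (hi q))) (Fin.natAdd 5 s) (Fin.natAdd 5 u) =
        if (s = Fin.castAdd 6 (0 : Fin 1) ∧ u = Fin.natAdd 1 (lo q)) ∨ (s = Fin.natAdd 1 (lo q) ∧ u = Fin.castAdd 6 (0 : Fin 1)) then 1 else 0) := by
  have htb : ∀ (σ τ υ : Fin 7) (x : Fin 7 → Bool), d (Fin.natAdd 5 σ) (Fin.natAdd 5 τ) (Fin.natAdd 5 υ) =
      if ((((κ (Fin.append p x) ^^ κ (Fin.append p (bxor x (fun l => decide (l = υ))))) ^^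
              (κ (Fin.append p (bxor x (fun l => decide (l = τ)))) ^^ κ (Fin.append p (bxor (bxor x (fun l => decide (l = τ))) (fun l => decide (l = υ)))))) ^^
            ((κ (Fin.append p (bxor x (fun l => decide (l = σ)))) ^^ κ (Fin.append p (bxor (bxor x (fun l => decide (l = σ))) (fun l => decide (l = υ))))) ^^
              (κ (Fin.append p (bxor (bxor x (fun l => decide (l = σ))) (fun l => decide (l = τ)))) ^^
                κ (Fin.append p (bxor (bxor (bxor x (fun l => decide (l = σ))) (fun l => decide (l = τ))) (fun l => decide (l = υ)))))))) = true
      then 1 else 0 := by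
    intro σ τ υ x
    have h3 := tc5_third_rho_unit κ hκ p σ τ υ x zeroVec
    dsimp only at h3
    rw [hd, ← h3]
  refine ⟨fun a => ⟨a.val, by omega⟩, fun a => ⟨h + a.val, by omega⟩, fun a b hab => ?_, fun a b hab => ?_, fun a b hab => ?_,
    fun a => rfl, fun a => rfl, ?_⟩
  · exact Fin.ext (by simpa using congrArg Fin.val hab)
  · exact Fin.ext (by simpa using congrArg Fin.val hab)
  · have := congrArg Fin.val hab; simp at this; omega
  -- index identities in `Fin 7 = Fin (1 + 6)`
  have i0 : (Fin.castLE hk (Fin.castAdd h (Fin.castAdd h (0 : Fin 1))) : Fin 7) = Fin.castAdd 6 (0 : Fin 1) :=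
    Fin.ext (by simp)
  have ilo : ∀ a : Fin h, (Fin.castLE hk (Fin.castAdd h (Fin.natAdd 1 a)) : Fin 7) = Fin.natAdd 1 (⟨a.val, by omega⟩ : Fin 6) :=
    fun a => Fin.ext (by simp)
  have ihi : ∀ a : Fin h, (Fin.castLE hk (Fin.natAdd (1 + h) a) : Fin 7) = Fin.natAdd 1 (⟨h + a.val, by omega⟩ : Fin 6) :=
    fun a => Fin.ext (by simp; omega)
  have hT' : ∀ u v w x : Fin (1 + 6) → Bool,
      ((((κ (Fin.append p x) ^^ κ (Fin.append p (bxor x w))) ^^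
              (κ (Fin.append p (bxor x v)) ^^ κ (Fin.append p (bxor (bxor x v) w)))) ^^
            ((κ (Fin.append p (bxor x u)) ^^ κ (Fin.append p (bxor (bxor x u) w))) ^^
              (κ (Fin.append p (bxor (bxor x u) v)) ^^
                κ (Fin.append p (bxor (bxor (bxor x u) v) w)))))) =
      ((((u (Fin.castAdd 6 (0 : Fin 1)) &&
            decide ((∑ ii : Fin h, ((if (fun jj => v (Fin.natAdd 1 jj)) ((fun a : Fin h => (⟨a.val, by omega⟩ : Fin 6)) ii) = true then (1 : ZMod 2) else 0) * (if (fun jj => w (Fin.natAdd 1 jj)) ((fun a : Fin h => (⟨h + a.val, by omega⟩ : Fin 6)) ii) = true then (1 : ZMod 2) else 0) +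
              (if (fun jj => v (Fin.natAdd 1 jj)) ((fun a : Fin h => (⟨h + a.val, by omega⟩ : Fin 6)) ii) = true then (1 : ZMod 2) else 0) * (if (fun jj => w (Fin.natAdd 1 jj)) ((fun a : Fin h => (⟨a.val, by omega⟩ : Fin 6)) ii) = true then (1 : ZMod 2) else 0))) = 1)) ^^
          (v (Fin.castAdd 6 (0 : Fin 1)) &&
            decide ((∑ ii : Fin h, ((if (fun jj => u (Fin.natAdd 1 jj)) ((fun a : Fin h => (⟨a.val, by omega⟩ : Fin 6)) ii) = true then (1 : ZMod 2) else 0) * (if (fun jj => w (Fin.natAdd 1 jj)) ((fun a : Fin h => (⟨h + a.val, by omega⟩ : Fin 6)) ii) = true then (1 : ZMod 2) else 0) +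
              (if (fun jj => u (Fin.natAdd 1 jj)) ((fun a : Fin h => (⟨h + a.val, by omega⟩ : Fin 6)) ii) = true then (1 : ZMod 2) else 0) * (if (fun jj => w (Fin.natAdd 1 jj)) ((fun a : Fin h => (⟨a.val, by omega⟩ : Fin 6)) ii) = true then (1 : ZMod 2) else 0))) = 1))) ^^
          (w (Fin.castAdd 6 (0 : Fin 1)) &&
            decide ((∑ ii : Fin h, ((if (fun jj => u (Fin.natAdd 1 jj)) ((fun a : Fin h => (⟨a.val, by omega⟩ : Fin 6)) ii) = true then (1 : ZMod 2) else 0) * (if (fun jj => v (Fin.natAdd 1 jj)) ((fun a : Fin h => (⟨h + a.val, by omega⟩ : Fin 6)) ii) = true then (1 : ZMod 2) else 0) +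
              (if (fun jj => u (Fin.natAdd 1 jj)) ((fun a : Fin h => (⟨h + a.val, by omega⟩ : Fin 6)) ii) = true then (1 : ZMod 2) else 0) * (if (fun jj => v (Fin.natAdd 1 jj)) ((fun a : Fin h => (⟨a.val, by omega⟩ : Fin 6)) ii) = true then (1 : ZMod 2) else 0))) = 1)))) := by
    intro u v w x
    have e := hT u v w x
    simp only [i0, ilo, ihi] at e
    exact e
  refine ⟨hT', ?_⟩
  have ht := tlu_unit_table (n := 6) (h := h) (fun s : Fin (1 + 6) → Bool => κ (Fin.append p s))
    (fun a => ⟨a.val, by omega⟩) (fun a => ⟨h + a.val, by omega⟩)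
    (fun a b hab => Fin.ext (by simpa using congrArg Fin.val hab)) (fun a b hab => Fin.ext (by simpa using congrArg Fin.val hab))
    (fun a b hab => by have := congrArg Fin.val hab; simp at this; omega) _ (fun v w => rfl) hT'
  dsimp only at ht
  obtain ⟨t0, tlo, thi⟩ := ht
  refine ⟨fun s u => ?_, fun q s u => ?_, fun q s u => ?_⟩
  · rw [htb _ _ _ zeroVec]; exact t0 s u
  · rw [htb _ _ _ zeroVec]; exact tlo q s u
  · rw [htb _ _ _ zeroVec]; exact thi q s u

end Summit.QuantumAdvantage.QuantumAdvantage.Theorems.CubicForrelation.NearExactIsExact
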